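/-
COR-CM (cell pub-hodgecm2, stage 2 of the Hodge ladder): gap G-T / the shape of binder B01, unconditionally.  Seat
prover-pub-hodgecm2-b14 (gen 7), 2026-08-20.  Composition of `CorCM/Geometry/PerLShadow.lean` (the separating shadow)
with `CorCM/Model/CMTypeUniverse.lean` (a record-free universe with the CM-type facts M13 + M14).
-/
import Summits.HodgeConjecture.CorCM.Geometry.PerLShadow
import Summits.HodgeConjecture.CorCM.Model.CMTypeUniverse
import Summits.HodgeConjecture.CorCM.Interfaces
import HarnessLib

/-!
# `PerL → PerLFace` is not a universe-level implication (no hypotheses)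

`CorCM/Interfaces.lean` displays binder B01 `PerLFace_of_PerL : ∀ hHD hI h₁ h₃,
(Model.picardCMUniverse hHD hI h₁ h₃).PerL → (Model.picardCMUniverse hHD hI h₁ h₃).PerLFace` between the literal
stage-2 target `HC_CM_of_PerL` and the working one `HC_CM_of_PerLFace`, and its TYPING FINDING says that
`U.PerL → U.PeriodThmF` (`PerLFace := PeriodThmF`) "is NOT a formal consequence".  Kernel form, with no cited record and
no model input:

* `exists_perL_perL44_not_perLFace : ∃ U : Universe, U.PerL ∧ U.PerL44 ∧ ¬ U.PerLFace` — the PerL shadow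
  (`Universe.perLShadow`) of the CM-type universe (`cmTypeUniverse`); in particular the conclusion SHAPES `PerL`
  (`W_per^L`) and `PerL44` (PerL Thm 4.4) of stage 1 are satisfiable predicates on universes;
* `not_forall_perL_imp_perLFace : ¬ ∀ U : Universe, U.PerL → U.PerLFace` and
  `not_forall_perL44_imp_perLFace : ¬ ∀ U : Universe, U.PerL44 → U.PerLFace` — B01 is not the specialisation of a
  universe-level lemma; a discharge of B01 must use the model universe (stage "1b" of `HOME/CHAIN-MAP.md` §A0).

Nothing here refutes B01 and nothing is said about `PerL` on the model universe.
-/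

noncomputable section

namespace Summit.HodgeConjecture.CorCM

/-- **`PerL ∧ PerL44 ∧ ¬ PerLFace` is satisfiable**, unconditionally: the PerL shadow of the CM-type universe. -/
theorem exists_perL_perL44_not_perLFace : ∃ U : Universe, U.PerL ∧ U.PerL44 ∧ ¬ U.PerLFace :=
  cmTypeUniverse.exists_perL_and_not_periodThmF cmTypeUniverse_fact_eigenLine cmTypeUniverse_fact_alphaLine

/-- **Gap G-T, kernel form**: `∀ U, U.PerL → U.PerLFace` is FALSE.  The sextic period statement `PerL` does not
yield its face form `PerLFace := PeriodThmF` by any argument that is uniform in the universe. -/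
theorem not_forall_perL_imp_perLFace : ¬ ∀ U : Universe, U.PerL → U.PerLFace := by
  intro h
  obtain ⟨U, hP, -, hF⟩ := exists_perL_perL44_not_perLFace
  exact hF (h U hP)

/-- The same with PerL Thm 4.4's `∀ V` form: `∀ U, U.PerL44 → U.PerLFace` is FALSE ("Thm 4.4 transposed to the face
setting", rfwf §4.2, is a new statement, not a corollary). -/
theorem not_forall_perL44_imp_perLFace : ¬ ∀ U : Universe, U.PerL44 → U.PerLFace := by
  intro h
  obtain ⟨U, -, hP, hF⟩ := exists_perL_perL44_not_perLFace
  exact hF (h U hP)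

/-- Literal spelling with `PeriodThmF`: `∀ U, U.PerL → U.PeriodThmF` is FALSE. -/
theorem not_forall_perL_imp_periodThmF : ¬ ∀ U : Universe, U.PerL → U.PeriodThmF :=
  not_forall_perL_imp_perLFace

end Summit.HodgeConjecture.CorCM

end
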